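import Summits.HubbardSuperconductivity.HubbardSuperconductivity.Theorems.AnisotropyChordSpinMonotoneExchangeBound
import Summits.HubbardSuperconductivity.HubbardSuperconductivity.Theorems.AnisotropyChordSpinMonotoneDefs
import Summits.HubbardSuperconductivity.HubbardSuperconductivity.Theorems.LevyLogBootstrapBlock2InfDivXXZAutSymmetry
import Mathlib.Combinatorics.SimpleGraph.CompleteMultipartite

/-!
# Route `AnisotropyChord`: THEOREM VI in full — on every connected COMPLETE MULTIPARTITE graph the
# Casimir `⟨𝐒²_tot⟩` and the condensate `Λ` of the sector ground states are non-decreasing in the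
# anisotropy (all sectors, all `Δ₁ ≤ Δ₂ ≤ 1`); the `2×2` torus (`M_Δ` at `L ≤ 2`) and `K_r(t)`

`H(Δ) = xxzHamiltonian 1 G (−1) Δ` (spin ½), `Λ(ψ) = Re⟨ψ, S⁺_tot S⁻_tot ψ⟩`, sector ground states and
the conjectures `U_vt = VertexTransitiveCondensateMonotone`, `M_Δ = TorusCondensateMonotone` as in
`…SpinMonotoneDefs`.  THEOREM VI of the theory seat `hubbard-h0-rotor-theory-1` (cycle 4: `K_{m,…,m}`,
all sectors; block form `casimir_monotone_of_block`, `K_n` case `completeGraph_condensate_monotone`)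
is proved for EVERY connected complete multipartite graph `K_{m₁,…,m_p}` (Mathlib's
`SimpleGraph.IsCompleteMultipartite`: non-adjacency is transitive), equal parts or not:
* `sectorGS_comp_eq_self` — Perron–Frobenius symmetry: on a connected graph every sector ground
  vector of `H(Δ)` is FIXED by the relabelling along every graph automorphism (the nonnegative
  Perron vector of `xxz_sector_perronFrobenius` has a positive coordinate sum, preserved by
  relabelling); `sectorGS_expect_eq_of_sectorGS` — uniqueness gives the case `Δ₁ = Δ₂`;
* non-adjacent vertices of a complete multipartite graph are twins (`adj_congr_of_not_adj`), their
  transposition is an automorphism (`adj_swap_iff_of_twins`), so sector ground states satisfy the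
  exchange IDENTITY of `…SpinMonotoneExchangeBound` (`completeMultipartite_re_totalSpinSq_eq`);
* `completeMultipartite_totalSpinSq_monotone` / `completeMultipartite_condensate_monotone` — THEOREM
  VI (upper-block form + Theorem V); `condensateMonotone_of_completeMultipartite` — `U_vt`'s
  conclusion verbatim with `IsVertexTransitive` REPLACED by `IsCompleteMultipartite` (covers the
  non-vertex-transitive `K_{1,2}`, `K_{2,3}`, …);
* `torusCondensateMonotone_of_le_two` — `torusGraph 2 2 = C₄ = K_{2,2}` and `torusGraph 2 1` are
  complete multipartite (`decide`), so `M_Δ` holds verbatim for `L ≤ 2`, ALL sectors: the smallest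
  vertex-transitive instance (director-hubbard START-HERE 2026-08-27 (iii)) decided in Lean without
  the closed form `Λ = 2(2+t)²/(2+t²)`;
* `completeEquipartiteGraph_condensate_monotone` — the theory seat's `K_{t,…,t}` = Mathlib's
  `completeEquipartiteGraph r t`, `r ≥ 2` (connected, vertex-transitive), all sectors.
Not covered: tori `L ≥ 3` (`torusGraph 2 3 = K₃ □ K₃` is not complete multipartite); there
`totalSpinSq_sub_le_nonEdge_defect` locates any violation in non-edge singlet weight.
Sources: H. Tasaki, *Physics and Mathematics of Quantum Many-Body Systems* (2020) §2.1, §2.4,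
App. A.3; P. A. M. Dirac, Proc. R. Soc. A 123 (1929) 714.  No definition is introduced.
-/

set_option linter.dupNamespace false

noncomputable section

namespace Summit.HubbardSuperconductivity.HubbardSuperconductivity.Theorems.AnisotropyChord

open Matrix Complex Finset
open scoped ComplexOrder
open Literature.MathematicalPhysics.QuantumLattice Literature.Probability.LatticeModels
open Literature.Combinatorics.SimpleGraph (IsVertexTransitive)
open Summit.HubbardSuperconductivity.HubbardSuperconductivity.Theorems.LevyLogBootstrap
open Summit.HubbardSuperconductivity.HubbardSuperconductivity.Theorems.PolyaSchurPairBoson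

variable {V : Type*} [Fintype V] [DecidableEq V]

/-! ### Perron–Frobenius: sector ground vectors are fixed by graph automorphisms -/

/-- The sector value of a nonzero sector vector is `|V|/2 − W` for an attained weight `W`.
[folklore] -/
theorem exists_weight_of_mem_spinZSector {m : ℝ} {ψ : TensorIndex V 2 → ℂ}
    (hψ : ψ ∈ spinZSector (Λ := V) 1 m) (h0 : ψ ≠ 0) :
    ∃ W : ℕ, (∃ σ : TensorIndex V 2, (∑ z, (σ z : ℕ)) = W) ∧
      m = ((Fintype.card V * 1 : ℕ) : ℝ) / 2 - (W : ℝ) := by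
  obtain ⟨σ₀, hσ₀⟩ : ∃ σ₀, ψ σ₀ ≠ 0 := Function.ne_iff.mp h0
  refine ⟨∑ z, (σ₀ z : ℕ), ⟨σ₀, rfl⟩, ?_⟩
  have h1 := (LiebMattis.mem_spinZSector_iff (Λ := V) 1 m ψ).1 hψ σ₀ hσ₀
  rw [LiebMattis.magnetisation_eq_sub_weight] at h1
  have h2 : ((m : ℝ) : ℂ) =
      ((((Fintype.card V * 1 : ℕ) : ℝ) / 2 - ((∑ z, (σ₀ z : ℕ) : ℕ) : ℝ) : ℝ) : ℂ) := by
    rw [← h1]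
    push_cast
    ring
  exact_mod_cast h2

/-- **Perron–Frobenius symmetry of sector ground vectors.** On a connected finite graph, for any
real `Δ`, any sector value `m` and ANY vector `ψ` of the sector with `H(Δ)ψ = E_min(m)ψ`, the
relabelling `σ ↦ σ ∘ π` along a graph automorphism `π` FIXES `ψ` (the nonnegative Perron vector `ψ₀`
goes to `c·ψ₀` with `Σ_σ ψ₀(σ) > 0` preserved, so `c = 1`; `ψ ∈ ℂψ₀`). Tasaki (2020) §2.1, §2.4.
[folklore] -/
theorem sectorGS_comp_eq_self (G : SimpleGraph V) [DecidableRel G.Adj] (hG : G.Connected)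
    (Δ m : ℝ) (π : V ≃ V) (hπ : ∀ x y, G.Adj (π x) (π y) ↔ G.Adj x y)
    {ψ : TensorIndex V 2 → ℂ} (hψ : ψ ∈ spinZSector (Λ := V) 1 m)
    (hH : xxzHamiltonian 1 G (-1) Δ *ᵥ ψ =
      ((lowestEnergyInSector 1 (xxzHamiltonian 1 G (-1) Δ) m : ℝ) : ℂ) • ψ) :
    (fun σ : TensorIndex V 2 => ψ (σ ∘ π)) = ψ := by
  by_cases hψ0 : ψ = 0
  · subst hψ0; rfl
  obtain ⟨W, hW, hmW⟩ := exists_weight_of_mem_spinZSector hψ hψ0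
  subst hmW
  obtain ⟨⟨ψ₀, hψ₀K, hψ₀0, hψ₀pos, hψ₀H⟩, huniq⟩ := xxz_sector_perronFrobenius G hG Δ W hW
  have hHinv := xxzHamiltonian_submatrix_comp 1 G (-1) Δ π hπ
  -- Step 1: the Perron vector is fixed by the relabelling.
  have hfix : (fun σ : TensorIndex V 2 => ψ₀ (σ ∘ π)) = ψ₀ := by
    set ψ₀' : TensorIndex V 2 → ℂ := fun σ => ψ₀ (σ ∘ π) with hψ₀'def
    have hK' : ψ₀' ∈ spinZSector (Λ := V) 1 (((Fintype.card V * 1 : ℕ) : ℝ) / 2 - (W : ℝ)) :=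
      comp_mem_spinZSector π hψ₀K
    have hH' : xxzHamiltonian 1 G (-1) Δ *ᵥ ψ₀' =
        ((lowestEnergyInSector 1 (xxzHamiltonian 1 G (-1) Δ)
          (((Fintype.card V * 1 : ℕ) : ℝ) / 2 - (W : ℝ)) : ℝ) : ℂ) • ψ₀' := by
      rw [hψ₀'def, mulVec_comp_of_submatrix_eq π hHinv ψ₀]
      funext σ
      rw [hψ₀H]
      rfl
    obtain ⟨c, hc⟩ := huniq ψ₀ ψ₀' hψ₀K hK' hψ₀H hH' hψ₀0
    have hsum : ∑ σ, ψ₀' σ = ∑ σ, ψ₀ σ :=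
      Fintype.sum_bijective _ (bijective_comp_equiv (q := 2) π) _ _ fun σ => rfl
    have hS0 : (∑ σ, ψ₀ σ) ≠ 0 := by
      obtain ⟨σ₁, hσ₁⟩ : ∃ σ₁, ψ₀ σ₁ ≠ 0 := Function.ne_iff.mp hψ₀0
      intro hS
      have hre : (∑ σ, ψ₀ σ).re = 0 := by rw [hS, Complex.zero_re]
      rw [Complex.re_sum] at hre
      have hle : (ψ₀ σ₁).re ≤ ∑ σ, (ψ₀ σ).re :=
        Finset.single_le_sum (fun σ _ => (hψ₀pos σ).1) (Finset.mem_univ σ₁)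
      have hpos : 0 < (ψ₀ σ₁).re := by
        rcases (hψ₀pos σ₁).1.lt_or_eq with h | h
        · exact h
        · exact absurd (Complex.ext (by rw [Complex.zero_re]; exact h.symm)
            (by rw [Complex.zero_im]; exact (hψ₀pos σ₁).2)) hσ₁
      linarith
    have hc1 : c = 1 := by
      have h1 : ∑ σ, ψ₀' σ = c * ∑ σ, ψ₀ σ := by
        rw [hc]
        simp only [Pi.smul_apply, smul_eq_mul, Finset.mul_sum]
      rw [hsum] at h1
      have h2 : (1 : ℂ) * ∑ σ, ψ₀ σ = c * ∑ σ, ψ₀ σ := by rw [one_mul]; exact h1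
      exact (mul_right_cancel₀ hS0 h2).symm
    rw [hc, hc1, one_smul]
  -- Step 2: `ψ` is a multiple of the Perron vector.
  obtain ⟨c', hc'⟩ := huniq ψ₀ ψ hψ₀K hψ hψ₀H hH hψ₀0
  funext σ
  have h : ψ₀ (σ ∘ π) = ψ₀ σ := congrFun hfix σ
  rw [hc', Pi.smul_apply, Pi.smul_apply, h]

/-- **Equal-anisotropy case**: two normalised ground vectors of the same sector (connected graph,
any `Δ`) have the same expectations, `⟨ψ, Aψ⟩ = ⟨φ, Aφ⟩` — Perron–Frobenius uniqueness makes them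
unimodular multiples of each other. Tasaki (2020) §2.4. [folklore] -/
theorem sectorGS_expect_eq_of_sectorGS (G : SimpleGraph V) [DecidableRel G.Adj] (hG : G.Connected)
    (Δ m : ℝ) {ψ φ : TensorIndex V 2 → ℂ}
    (hψ : ψ ∈ spinZSector (Λ := V) 1 m) (hψn : star ψ ⬝ᵥ ψ = 1)
    (hHψ : xxzHamiltonian 1 G (-1) Δ *ᵥ ψ =
      ((lowestEnergyInSector 1 (xxzHamiltonian 1 G (-1) Δ) m : ℝ) : ℂ) • ψ)
    (hφ : φ ∈ spinZSector (Λ := V) 1 m) (hφn : star φ ⬝ᵥ φ = 1)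
    (hHφ : xxzHamiltonian 1 G (-1) Δ *ᵥ φ =
      ((lowestEnergyInSector 1 (xxzHamiltonian 1 G (-1) Δ) m : ℝ) : ℂ) • φ)
    (A : Op V 2) :
    star ψ ⬝ᵥ (A *ᵥ ψ) = star φ ⬝ᵥ (A *ᵥ φ) := by
  have hψ0 : ψ ≠ 0 := by
    intro h
    rw [h, star_zero, zero_dotProduct] at hψn
    exact zero_ne_one hψn
  obtain ⟨W, hW, hmW⟩ := exists_weight_of_mem_spinZSector hψ hψ0
  subst hmW
  obtain ⟨-, huniq⟩ := xxz_sector_perronFrobenius G hG Δ W hW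
  obtain ⟨c, hc⟩ := huniq ψ φ hψ hφ hHψ hHφ hψ0
  have hcc : (starRingEnd ℂ) c * c = 1 := by
    have h1 : star φ ⬝ᵥ ((1 : Op V 2) *ᵥ φ) =
        ((starRingEnd ℂ) c * c) * (star ψ ⬝ᵥ ((1 : Op V 2) *ᵥ ψ)) := by
      rw [hc, star_smul_dotProduct_mulVec_smul]
    rw [one_mulVec, one_mulVec, hφn, hψn, mul_one] at h1
    exact h1.symm
  rw [hc, star_smul_dotProduct_mulVec_smul, hcc, one_mul]

/-! ### Complete multipartite graphs: non-adjacent vertices are twins, swaps are automorphisms -/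

omit [Fintype V] [DecidableEq V] in
/-- In a complete multipartite graph (non-adjacency transitive) two non-adjacent vertices have the
same neighbours. [folklore] -/
theorem adj_congr_of_not_adj {G : SimpleGraph V} (h : G.IsCompleteMultipartite) {x y : V}
    (hxy : ¬G.Adj x y) (z : V) : G.Adj x z ↔ G.Adj y z := by
  constructor
  · intro hxz
    by_contra hyz
    exact h.trans x y z hxy hyz hxz
  · intro hyz
    by_contra hxz
    exact h.trans y x z (fun h' => hxy h'.symm) hxz hyz

omit [Fintype V] in
/-- The transposition of two twins (vertices with the same neighbours) is a graph automorphism.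
[folklore] -/
theorem adj_swap_iff_of_twins {G : SimpleGraph V} {x y : V} (h : ∀ z, G.Adj x z ↔ G.Adj y z)
    (a b : V) : G.Adj (Equiv.swap x y a) (Equiv.swap x y b) ↔ G.Adj a b := by
  have key : ∀ a c : V, G.Adj (Equiv.swap x y a) c ↔ G.Adj a (Equiv.swap x y c) := by
    intro a c
    by_cases hax : a = x
    · rw [hax, Equiv.swap_apply_left]
      by_cases hcx : c = x
      · rw [hcx, Equiv.swap_apply_left]
        exact ⟨fun h' => h'.symm, fun h' => h'.symm⟩
      · by_cases hcy : c = y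
        · rw [hcy, Equiv.swap_apply_right]
          exact ⟨fun h' => (G.irrefl h').elim, fun h' => (G.irrefl h').elim⟩
        · rw [Equiv.swap_apply_of_ne_of_ne hcx hcy]
          exact (h c).symm
    · by_cases hay : a = y
      · rw [hay, Equiv.swap_apply_right]
        by_cases hcx : c = x
        · rw [hcx, Equiv.swap_apply_left]
          exact ⟨fun h' => (G.irrefl h').elim, fun h' => (G.irrefl h').elim⟩
        · by_cases hcy : c = y
          · rw [hcy, Equiv.swap_apply_right]
            exact ⟨fun h' => h'.symm, fun h' => h'.symm⟩
          · rw [Equiv.swap_apply_of_ne_of_ne hcx hcy]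
            exact h c
      · rw [Equiv.swap_apply_of_ne_of_ne hax hay]
        by_cases hcx : c = x
        · rw [hcx, Equiv.swap_apply_left]
          exact ⟨fun h' => ((h a).1 h'.symm).symm, fun h' => ((h a).2 h'.symm).symm⟩
        · by_cases hcy : c = y
          · rw [hcy, Equiv.swap_apply_right]
            exact ⟨fun h' => ((h a).2 h'.symm).symm, fun h' => ((h a).1 h'.symm).symm⟩
          · rw [Equiv.swap_apply_of_ne_of_ne hcx hcy]
  rw [key, Equiv.swap_apply_self]

/-- **Sector ground states on a complete multipartite graph are twin-symmetric**: for `G`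
connected and complete multipartite, any sector ground vector `ψ` of `H(Δ)` and any NON-adjacent
pair `x, y`: `ψ(σ ∘ swap_{xy}) = ψ(σ)`. [folklore] -/
theorem completeMultipartite_comp_swap_eq_self (G : SimpleGraph V) [DecidableRel G.Adj]
    (hG : G.Connected) (hcm : G.IsCompleteMultipartite) (Δ m : ℝ)
    {ψ : TensorIndex V 2 → ℂ} (hψ : ψ ∈ spinZSector (Λ := V) 1 m)
    (hH : xxzHamiltonian 1 G (-1) Δ *ᵥ ψ =
      ((lowestEnergyInSector 1 (xxzHamiltonian 1 G (-1) Δ) m : ℝ) : ℂ) • ψ)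
    {x y : V} (hna : ¬G.Adj x y) (σ : TensorIndex V 2) :
    ψ (σ ∘ Equiv.swap x y) = ψ σ :=
  congrFun (sectorGS_comp_eq_self G hG Δ m (Equiv.swap x y)
    (adj_swap_iff_of_twins (adj_congr_of_not_adj hcm hna)) hψ hH) σ

/-- Hence the **exchange identity** for sector ground states of a connected complete multipartite
graph: `Re⟨ψ,𝐒²ψ⟩ = (¾|V| + ½|E(Gᶜ)|)·‖ψ‖² − 2 Re⟨ψ, H(1)ψ⟩` (the theory seat's "block step",
discharged by Perron–Frobenius). [folklore] -/
theorem completeMultipartite_re_totalSpinSq_eq (G : SimpleGraph V) [DecidableRel G.Adj]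
    (hG : G.Connected) (hcm : G.IsCompleteMultipartite) {Δ m : ℝ}
    {ψ : TensorIndex V 2 → ℂ} (hψ : ψ ∈ spinZSector (Λ := V) 1 m)
    (hH : xxzHamiltonian 1 G (-1) Δ *ᵥ ψ =
      ((lowestEnergyInSector 1 (xxzHamiltonian 1 G (-1) Δ) m : ℝ) : ℂ) • ψ) :
    (star ψ ⬝ᵥ ((totalSpinSq 1 : Op V 2) *ᵥ ψ)).re =
      ((3 / 4 : ℝ) * (Fintype.card V : ℝ) + (1 / 2 : ℝ) * (Gᶜ.edgeFinset.card : ℝ)) * (star ψ ⬝ᵥ ψ).re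
        - 2 * (star ψ ⬝ᵥ ((xxzHamiltonian 1 G (-1) 1 : Op V 2) *ᵥ ψ)).re :=
  re_totalSpinSq_eq_of_comp_swap G fun _ _ _ hna σ =>
    completeMultipartite_comp_swap_eq_self G hG hcm Δ m hψ hH hna σ

/-! ### THEOREM VI on complete multipartite graphs -/

/-- **THEOREM VI (theory seat `hubbard-h0-rotor-theory-1`, cycle 4), complete multipartite graphs,
Casimir form.** `G` finite, connected, complete multipartite; any sector `M`; `Δ₁ ≤ Δ₂ ≤ 1`;
normalised sector ground states `ψ₁` of `H(Δ₁)`, `ψ₂` of `H(Δ₂)`: `⟨𝐒²_tot⟩_{ψ₁} ≤ ⟨𝐒²_tot⟩_{ψ₂}`.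
[folklore] -/
theorem completeMultipartite_totalSpinSq_monotone (G : SimpleGraph V) [DecidableRel G.Adj]
    (hG : G.Connected) (hcm : G.IsCompleteMultipartite) {M Δ₁ Δ₂ : ℝ} (h12 : Δ₁ ≤ Δ₂) (h2 : Δ₂ ≤ 1)
    {ψ₁ ψ₂ : (V → Fin 2) → ℂ}
    (g₁m : ψ₁ ∈ spinZSector (Λ := V) 1 M) (g₁n : star ψ₁ ⬝ᵥ ψ₁ = 1)
    (g₁e : (xxzHamiltonian 1 G (-1) Δ₁ : Op V 2) *ᵥ ψ₁ =
      ((lowestEnergyInSector 1 (xxzHamiltonian 1 G (-1) Δ₁) M : ℝ) : ℂ) • ψ₁)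
    (g₂m : ψ₂ ∈ spinZSector (Λ := V) 1 M) (g₂n : star ψ₂ ⬝ᵥ ψ₂ = 1)
    (g₂e : (xxzHamiltonian 1 G (-1) Δ₂ : Op V 2) *ᵥ ψ₂ =
      ((lowestEnergyInSector 1 (xxzHamiltonian 1 G (-1) Δ₂) M : ℝ) : ℂ) • ψ₂) :
    (star ψ₁ ⬝ᵥ ((totalSpinSq 1 : Op V 2) *ᵥ ψ₁)).re ≤
      (star ψ₂ ⬝ᵥ ((totalSpinSq 1 : Op V 2) *ᵥ ψ₂)).re := by
  rcases h12.lt_or_eq with hlt | heq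
  · have k₁ := re_totalSpinSq_le_graph G ψ₁
    rw [g₁n, Complex.one_re, mul_one] at k₁
    have k₂ := completeMultipartite_re_totalSpinSq_eq G hG hcm g₂m g₂e
    rw [g₂n, Complex.one_re, mul_one] at k₂
    exact casimir_monotone_of_upper_block 1 G (by norm_num : (0 : ℝ) ≤ 2) hlt h2
      g₁m g₁n g₁e g₂m g₂n g₂e k₁ k₂
  · subst heq
    exact le_of_eq (congrArg Complex.re
      (sectorGS_expect_eq_of_sectorGS G hG Δ₁ M g₁m g₁n g₁e g₂m g₂n g₂e _))

/-- **THEOREM VI, condensate form (`U_vt` on complete multipartite graphs).** Same hypotheses: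
`Λ(ψ₁) ≤ Λ(ψ₂)`, `Λ(ψ) = Re⟨ψ, S⁺_tot S⁻_tot ψ⟩` (`Re⟨ψ,𝐒²ψ⟩ = Λ(ψ) + (M² − M)‖ψ‖²`). [folklore] -/
theorem completeMultipartite_condensate_monotone (G : SimpleGraph V) [DecidableRel G.Adj]
    (hG : G.Connected) (hcm : G.IsCompleteMultipartite) {M Δ₁ Δ₂ : ℝ} (h12 : Δ₁ ≤ Δ₂) (h2 : Δ₂ ≤ 1)
    {ψ₁ ψ₂ : (V → Fin 2) → ℂ}
    (g₁m : ψ₁ ∈ spinZSector (Λ := V) 1 M) (g₁n : star ψ₁ ⬝ᵥ ψ₁ = 1)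
    (g₁e : (xxzHamiltonian 1 G (-1) Δ₁ : Op V 2) *ᵥ ψ₁ =
      ((lowestEnergyInSector 1 (xxzHamiltonian 1 G (-1) Δ₁) M : ℝ) : ℂ) • ψ₁)
    (g₂m : ψ₂ ∈ spinZSector (Λ := V) 1 M) (g₂n : star ψ₂ ⬝ᵥ ψ₂ = 1)
    (g₂e : (xxzHamiltonian 1 G (-1) Δ₂ : Op V 2) *ᵥ ψ₂ =
      ((lowestEnergyInSector 1 (xxzHamiltonian 1 G (-1) Δ₂) M : ℝ) : ℂ) • ψ₂) :
    (star ψ₁ ⬝ᵥ (((∑ x, onSite x (spinRaise 1)) * (∑ y, onSite y (spinLower 1)) : Op V 2) *ᵥ ψ₁)).re ≤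
      (star ψ₂ ⬝ᵥ (((∑ x, onSite x (spinRaise 1)) * (∑ y, onSite y (spinLower 1)) : Op V 2) *ᵥ ψ₂)).re := by
  have h := completeMultipartite_totalSpinSq_monotone G hG hcm h12 h2 g₁m g₁n g₁e g₂m g₂n g₂e
  rw [OneMagnon.re_totalSpinSq_eq_condensate_add g₁m, OneMagnon.re_totalSpinSq_eq_condensate_add g₂m,
    g₁n, g₂n] at h
  simpa using h

/-- **`U_vt` with vertex-transitivity replaced by complete multipartiteness** (statement shape of
`VertexTransitiveCondensateMonotone`, verbatim otherwise): on every finite connected complete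
multipartite graph, in every sector, for `−1 ≤ Δ₁ ≤ Δ₂ ≤ 1`, the condensate of normalised sector
ground states is non-decreasing from `Δ₁` to `Δ₂`.  Covers non-vertex-transitive graphs
(`K_{m₁,…,m_p}` with unequal parts). [folklore] -/
theorem condensateMonotone_of_completeMultipartite :
    ∀ (V : Type) [Fintype V] [DecidableEq V] (G : SimpleGraph V) [DecidableRel G.Adj],
      G.Connected → G.IsCompleteMultipartite → ∀ (M Δ₁ Δ₂ : ℝ), -1 ≤ Δ₁ → Δ₁ ≤ Δ₂ → Δ₂ ≤ 1 →
        ∀ ψ₁ ψ₂ : TensorIndex V 2 → ℂ,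
          ψ₁ ∈ spinZSector (Λ := V) 1 M → star ψ₁ ⬝ᵥ ψ₁ = 1 →
          xxzHamiltonian 1 G (-1) Δ₁ *ᵥ ψ₁ =
            ((lowestEnergyInSector 1 (xxzHamiltonian 1 G (-1) Δ₁) M : ℝ) : ℂ) • ψ₁ →
          ψ₂ ∈ spinZSector (Λ := V) 1 M → star ψ₂ ⬝ᵥ ψ₂ = 1 →
          xxzHamiltonian 1 G (-1) Δ₂ *ᵥ ψ₂ =
            ((lowestEnergyInSector 1 (xxzHamiltonian 1 G (-1) Δ₂) M : ℝ) : ℂ) • ψ₂ →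
          (star ψ₁ ⬝ᵥ (((∑ x, onSite x (spinRaise 1)) * (∑ y, onSite y (spinLower 1)) : Op V 2) *ᵥ ψ₁)).re
            ≤ (star ψ₂ ⬝ᵥ (((∑ x, onSite x (spinRaise 1)) * (∑ y, onSite y (spinLower 1)) : Op V 2) *ᵥ ψ₂)).re :=
  fun _ _ _ G _ hG hcm _ _ _ _ h12 h2 _ _ g₁m g₁n g₁e g₂m g₂n g₂e =>
    completeMultipartite_condensate_monotone G hG hcm h12 h2 g₁m g₁n g₁e g₂m g₂n g₂e

/-! ### The smallest tori: `M_Δ` (`TorusCondensateMonotone`) holds for `L ≤ 2`, all sectors -/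

/-- The `2×2` torus `torusGraph 2 2` (`= C₄ = K_{2,2}`: the two non-edges are the two diagonals) is
complete multipartite. [folklore] -/
theorem torusGraph_two_two_isCompleteMultipartite : (torusGraph 2 2).IsCompleteMultipartite :=
  ⟨by decide⟩

/-- The `1×1` torus `torusGraph 2 1` (one vertex, no edge) is complete multipartite. [folklore] -/
theorem torusGraph_two_one_isCompleteMultipartite : (torusGraph 2 1).IsCompleteMultipartite :=
  ⟨by decide⟩

/-- **`M_Δ` on the tori of side `L ≤ 2`, all sectors** — `TorusCondensateMonotone` of
`…SpinMonotoneDefs` verbatim, restricted to `L ≤ 2` (the `2×2` torus is `K_{2,2}`, THEOREM VI;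
`L = 1` is a single site): the smallest vertex-transitive instance of `U_vt`/`M_Δ`, decided in
Lean (director-hubbard START-HERE 2026-08-27 (iii)); no closed form needed. [folklore] -/
theorem torusCondensateMonotone_of_le_two :
    ∀ (L : ℕ) [NeZero L], L ≤ 2 → ∀ (M Δ₁ Δ₂ : ℝ), -1 ≤ Δ₁ → Δ₁ ≤ Δ₂ → Δ₂ ≤ 1 →
      ∀ ψ₁ ψ₂ : TensorIndex (TorusSite 2 L) 2 → ℂ,
        ψ₁ ∈ spinZSector (Λ := TorusSite 2 L) 1 M → star ψ₁ ⬝ᵥ ψ₁ = 1 →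
          xxzHamiltonian 1 (torusGraph 2 L) (-1) Δ₁ *ᵥ ψ₁ =
            ((lowestEnergyInSector 1 (xxzHamiltonian 1 (torusGraph 2 L) (-1) Δ₁) M : ℝ) : ℂ) • ψ₁ →
        ψ₂ ∈ spinZSector (Λ := TorusSite 2 L) 1 M → star ψ₂ ⬝ᵥ ψ₂ = 1 →
          xxzHamiltonian 1 (torusGraph 2 L) (-1) Δ₂ *ᵥ ψ₂ =
            ((lowestEnergyInSector 1 (xxzHamiltonian 1 (torusGraph 2 L) (-1) Δ₂) M : ℝ) : ℂ) • ψ₂ →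
        (star ψ₁ ⬝ᵥ (((∑ x, onSite x (spinRaise 1)) * (∑ y, onSite y (spinLower 1)) :
            Op (TorusSite 2 L) 2) *ᵥ ψ₁)).re
          ≤ (star ψ₂ ⬝ᵥ (((∑ x, onSite x (spinRaise 1)) * (∑ y, onSite y (spinLower 1)) :
            Op (TorusSite 2 L) 2) *ᵥ ψ₂)).re := by
  intro L _ hL M Δ₁ Δ₂ _ h12 h2 ψ₁ ψ₂ g₁m g₁n g₁e g₂m g₂n g₂e
  have hcm : (torusGraph 2 L).IsCompleteMultipartite := by
    obtain rfl | rfl : L = 1 ∨ L = 2 := by have := NeZero.ne L; omega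
    · exact torusGraph_two_one_isCompleteMultipartite
    · exact torusGraph_two_two_isCompleteMultipartite
  exact completeMultipartite_condensate_monotone (torusGraph 2 L) (torusGraph_connected_of_proj 2 L)
    hcm h12 h2 g₁m g₁n g₁e g₂m g₂n g₂e

/-! ### The theory seat's `K_{m,…,m}`: Mathlib's `completeEquipartiteGraph r t` -/

/-- `K_r(t)` with `r ≥ 2` parts of size `t ≥ 1` is connected (diameter `≤ 2`). [folklore] -/
theorem completeEquipartiteGraph_connected {r t : ℕ} (hr : 2 ≤ r) (ht : 0 < t) :
    (SimpleGraph.completeEquipartiteGraph r t).Connected := by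
  rw [SimpleGraph.connected_iff]
  refine ⟨fun v w => ?_, ⟨(⟨0, by omega⟩, ⟨0, ht⟩)⟩⟩
  by_cases h : v.1 = w.1
  · obtain ⟨j, hj⟩ : ∃ j : Fin r, j ≠ v.1 := by
      by_cases h0 : v.1.val = 0
      · exact ⟨⟨1, by omega⟩, fun hje => by have := congrArg Fin.val hje; simp [h0] at this⟩
      · exact ⟨⟨0, by omega⟩, fun hje => by have := congrArg Fin.val hje; simp at this; omega⟩
    have h1 : (SimpleGraph.completeEquipartiteGraph r t).Adj v (j, v.2) :=
      SimpleGraph.completeEquipartiteGraph_adj.2 (Ne.symm hj)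
    have h2 : (SimpleGraph.completeEquipartiteGraph r t).Adj (j, v.2) w :=
      SimpleGraph.completeEquipartiteGraph_adj.2 (by rw [← h]; exact hj)
    exact h1.reachable.trans h2.reachable
  · exact (SimpleGraph.completeEquipartiteGraph_adj.2 h).reachable

/-- `K_r(t)` is vertex-transitive (swap the two parts and the two positions). [folklore] -/
theorem completeEquipartiteGraph_isVertexTransitive (r t : ℕ) :
    IsVertexTransitive (SimpleGraph.completeEquipartiteGraph r t) := by
  intro v w
  refine ⟨{ toEquiv := Equiv.prodCongr (Equiv.swap v.1 w.1) (Equiv.swap v.2 w.2),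
            map_rel_iff' := ?_ }, ?_⟩
  · intro a b
    simp only [Equiv.prodCongr_apply, SimpleGraph.completeEquipartiteGraph_adj, Prod.map_fst]
    exact (Equiv.swap v.1 w.1).injective.ne_iff
  · show Prod.map (Equiv.swap v.1 w.1) (Equiv.swap v.2 w.2) v = w
    rw [Prod.map_apply, Equiv.swap_apply_left, Equiv.swap_apply_left]

/-- **THEOREM VI on `K_{t,…,t}` (`r ≥ 2` parts), all sectors, condensate form** — the theory seat's
statement (`CompleteEquipartiteSpinMonotone`), a vertex-transitive family on which `U_vt` holds in
EVERY sector: for `Δ₁ ≤ Δ₂ ≤ 1` and normalised sector ground states of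
`xxzHamiltonian 1 (completeEquipartiteGraph r t) (−1) Δ`, `Λ(ψ₁) ≤ Λ(ψ₂)`. [folklore] -/
theorem completeEquipartiteGraph_condensate_monotone {r t : ℕ} (hr : 2 ≤ r) (ht : 0 < t)
    {M Δ₁ Δ₂ : ℝ} (h12 : Δ₁ ≤ Δ₂) (h2 : Δ₂ ≤ 1)
    {ψ₁ ψ₂ : TensorIndex (Fin r × Fin t) 2 → ℂ}
    (g₁m : ψ₁ ∈ spinZSector (Λ := Fin r × Fin t) 1 M) (g₁n : star ψ₁ ⬝ᵥ ψ₁ = 1)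
    (g₁e : xxzHamiltonian 1 (SimpleGraph.completeEquipartiteGraph r t) (-1) Δ₁ *ᵥ ψ₁ =
      ((lowestEnergyInSector 1 (xxzHamiltonian 1 (SimpleGraph.completeEquipartiteGraph r t) (-1) Δ₁)
        M : ℝ) : ℂ) • ψ₁)
    (g₂m : ψ₂ ∈ spinZSector (Λ := Fin r × Fin t) 1 M) (g₂n : star ψ₂ ⬝ᵥ ψ₂ = 1)
    (g₂e : xxzHamiltonian 1 (SimpleGraph.completeEquipartiteGraph r t) (-1) Δ₂ *ᵥ ψ₂ =
      ((lowestEnergyInSector 1 (xxzHamiltonian 1 (SimpleGraph.completeEquipartiteGraph r t) (-1) Δ₂)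
        M : ℝ) : ℂ) • ψ₂) :
    (star ψ₁ ⬝ᵥ (((∑ x, onSite x (spinRaise 1)) * (∑ y, onSite y (spinLower 1)) :
        Op (Fin r × Fin t) 2) *ᵥ ψ₁)).re ≤
      (star ψ₂ ⬝ᵥ (((∑ x, onSite x (spinRaise 1)) * (∑ y, onSite y (spinLower 1)) :
        Op (Fin r × Fin t) 2) *ᵥ ψ₂)).re :=
  completeMultipartite_condensate_monotone (SimpleGraph.completeEquipartiteGraph r t)
    (completeEquipartiteGraph_connected hr ht)
    SimpleGraph.completeEquipartiteGraph.isCompleteMultipartite h12 h2 g₁m g₁n g₁e g₂m g₂n g₂e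

end Summit.HubbardSuperconductivity.HubbardSuperconductivity.Theorems.AnisotropyChord
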